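import Summits.QuantumFields.YangMills.Theorems.AlphaInputsT3ACv3NewtonLiftStencilRows
import Summits.QuantumFields.YangMills.Theorems.AlphaInputsT3ACv3AvgIterLocality
import Summits.QuantumFields.YangMills.Theorems.AlphaInputsT3ACv3AbelianTensorSums
import Literature.MathematicalPhysics.QuantumFieldTheory.Balaban1983to89.T3SectALandauChart
import HarnessLib

/-!
# Route `UnitScaleTilt`, crux K1 child «MinimiserStabilityRegPr» (stmt-QuantumFields-19200), stub `stub_existenceMinimalOrbit` (EX), route (α), node (46)∕M12 — **(T1) THE TWIST-EXACTNESS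
# DEFECT LETTER AT A `RegPr` BACKGROUND**: the stencil-gauge rows of the `obLift` kernel certificate (flatness `η` and the one-block oscillation `ω` of the relative gauges) discharged
# from print's regular space `𝔘_k(ε₀)` ALONE, `η ≤ 3ε₀·L^{−(K−n)}`, `ω ≤ 8ε₀` — k-UNIFORM

Cell `ym3-torus`, width seat `ym-ust-19200-w4` (gen 2; OWNER RULING M12 (AVG-SYM-46) SHAPE 2026-08-28 03:46:59Z: «(T1) twist-exactness defect — θ := transport inconsistency on the kernel
support ≤ holonomy of fine loops inside ONE (K−n)-block ≤ c·(L^{K−n})²·(ε₀L^{−2(K−n)}) = c·ε₀ k-UNIFORM by `RegPr.plaqSmall` … (T1) := ★w4-19200 g2, file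
`Theorems/UnitScaleTiltProp7TwistDefectOfRegPr.lean`»).  THEOREMS ONLY (0 `def`, 0 `sorry`).  YM₃ on T³ is a ladder rung (R3), not the Clay problem; nothing here claims the stub,
the crux, d = 4 or the mass gap.

LOCATED.  The (46) supplier of record is `H := R ∘ (QSym U₀ ∘ R)⁻¹` with `R` the one-block exact lift `obLift` (★alpha-2) twisted by the GAUGE FRAMES of the centre-anchored comb
gauges `σ_c := axialT U₀ (toFine (K−n) c₋)` (★w4-19936 g2's certificate `NewtonLiftFramed.exists_obLift_gaugeKernel`, whose binders (γ) `hosc` — the oscillation `ω` of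
`σ_cσ_{c′}⁻¹` between a fine site of the block of `c′₋` and its centre — and (δ) — the flatness `η′` of `U₀^{σ_{c′}}` on the plaquette's bonds — are the only places the background
enters).  ★w4-19936 g2's `…NewtonLiftStencilRows` (landed minutes before this file) reads both rows off a PLAQUETTE BOUND `δ` on the two-cell box:
`norm_gaugeAct_centreAxial_sub_one_le` (`η = (d⌊L^k∕2⌋ + L^k)·δ`) and `norm_relGauge_centre_osc_le` (`ω = (η + η′)·d⌊L^k∕2⌋`).  At a background of print's regular space
(`T3PrintedRegularMinimiser.RegPr F n K ε₀ U₀`: EVERY finest plaquette within `ε₀L^{−2(K−n)}` of `1`) the box condition is vacuous, so with `k = K − n`, `d = 3`: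
  `η ≤ (5∕2)L^k·ε₀L^{−2k} ≤ 3ε₀·L^{−k}`,   `ω ≤ 2η·(3∕2)L^k ≤ 8ε₀`  — k-UNIFORM, as the ruling predicted (`c·(L^k)²·ε₀L^{−2k}`).
THIS FILE is that knit, in the EXACT binder shapes of `exists_obLift_gaugeKernel` (γ)∕(δ), the gauges written INLINE (`fun c ↦ axialT U₀ (toFine (K − n) c.src)`, no definition):
* §1 `plaq_le_of_regPr'` (the plaquette radius of `RegPr`, light-import twin of `Prop7BlendClause1.plaq_le_of_regPr`), `eta_le`, `omega_le` (the arithmetic);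
* §2 ★ `flat_centreAxial_of_regPr` — (δ)'s flatness on the two blocks of every coarse bond: `‖U₀^{σ_c}(b) − 1‖ ≤ 3ε₀·L^{−(K−n)}`;
* §3 ★★ `osc_centreAxial_of_regPr` — (γ)'s `hosc` VERBATIM with `ω := 8ε₀`: for `b` in the two blocks of `c` and `c′₋ = coarsen (K−n) b₋`,
  `‖σ_c(b₋)σ_{c′}(b₋)⁻¹ − σ_c^{(K−n)}(c′₋)σ_{c′}^{(K−n)}(c′₋)⁻¹‖ ≤ 8ε₀`;
* §4 `stencilRows_of_regPr` — both, packaged.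
DISPLAYED: the no-wrap margin `4L^{K−n} ≤ |T|` of the two-cell chart (fails only on the 2-block torus `m + n = 0`; `sitesPerDir 0 = L^{K−n}·2L^{m+n}`).

HONEST SCOPE.  Bookkeeping over ★w4-19936 g2's stencil rows and ★w5-19936's two-cell chart; nothing of [Balaban1985Variational]∕[Balaban1985Averaging] is asserted;
`--supports stmt-QuantumFields-19200`, count-neutral.

References: T. Bałaban, CMP 98 (1985) 17–51 [Balaban1985Averaging] ((8) p.18, (11)–(13) p.19, (19) p.21, pp.24–25); CMP 102 (1985) 277–309 [Balaban1985Variational] ((6) p.278,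
(14) p.280, (46) p.285).
-/

set_option autoImplicit false

noncomputable section

open scoped Matrix.Norms.L2Operator

namespace Summit.QuantumFields.YangMills.Theorems.Prop7TwistDefectOfRegPr

open Literature.MathematicalPhysics.QuantumFieldTheory.Balaban1983to89
open Literature.MathematicalPhysics.QuantumFieldTheory.Balaban1983to89.T3ContinuumYM3Torus
open Literature.MathematicalPhysics.QuantumFieldTheory.Balaban1983to89.T3PrintedRegularMinimiser (RegPr)
open Literature.MathematicalPhysics.QuantumFieldTheory.Balaban1983to89.T3SectALandauChart (pos_of_regPr)
open Literature.MathematicalPhysics.QuantumFieldTheory.Balaban1983to89.B5Eq118OneStroke (iterBlockOf)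
open Literature.MathematicalPhysics.QuantumFieldTheory.Balaban1983to89.B10Eq38TorusDomains (toFine)
open B10Eq27TorusAxialLog (axialT)
open T4Continuum
open Summit.QuantumFields.Balaban3D.Carriers (coarsen)
open Summit.QuantumFields.YangMills.Theorems.AvgIterLocality (coarsen_eq_iterBlockOf)
open Summit.QuantumFields.YangMills.Theorems.AbelianEML.Tensor (le_standing)
open Summit.QuantumFields.YangMills.Theorems.NewtonLiftFramed (norm_gaugeAct_centreAxial_sub_one_le norm_relGauge_centre_osc_le)

variable (F : T3Family) (n K : ℕ)

/-! ## §1 The plaquette radius of `RegPr` and the arithmetic of `η`, `ω` -/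

/-- The plaquette clause of print's regular space (6)∕(14): `dist1(U₀(∂p)) ≤ ε₀·L^{−2(K−n)}` (light-import twin of `Prop7BlendClause1.plaq_le_of_regPr`). [cite: Balaban1985Variational, (6) p.278, (14) p.280] -/
theorem plaq_le_of_regPr' {ε₀ : ℝ} {U₀ : GaugeField (F.P K) 0 (Matrix.specialUnitaryGroup (Fin 2) ℂ)} (hreg : RegPr F n K ε₀ U₀) (p : Plaq (F.P K) 0) :
    GaugeGroup.dist1 (GaugeField.plaqHol U₀ p) ≤ ε₀ * (((F.L : ℝ) ^ (K - n)) ^ 2)⁻¹ := by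
  have h1 := (hreg.plaqSmall p).le
  have h2 : T3RegularMinimiser.regThreshold F n K ε₀ = ε₀ * (((F.L : ℝ) ^ (K - n)) ^ 2)⁻¹ := by
    rw [T3RegularMinimiser.regThreshold, inv_pow, mul_comm 2 (K - n), pow_mul]
  rwa [h2] at h1

/-- The flatness constant: `(3⌊L^k∕2⌋ + L^k)·(ε₀L^{−2k}) ≤ 3ε₀·L^{−k}`. [folklore] -/
theorem eta_le {ε₀ : ℝ} (hε₀ : 0 ≤ ε₀) :
    (((F.P K).d * ((F.P K).L ^ (K - n) / 2) + (F.P K).L ^ (K - n) : ℕ) : ℝ) * (ε₀ * (((F.L : ℝ) ^ (K - n)) ^ 2)⁻¹) ≤ 3 * ε₀ * ((F.L : ℝ) ^ (K - n))⁻¹ := by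
  have hL : (0 : ℝ) < (F.L : ℝ) ^ (K - n) := by
    have : (0 : ℝ) < F.L := by have := F.hL.2; exact_mod_cast (by omega : 0 < F.L)
    positivity
  have hd : ((F.P K).d : ℕ) = 3 := T3Family.P_d F K
  have hLF : ((F.P K).L : ℕ) = F.L := by norm_cast
  have hhalf : ((F.L ^ (K - n) / 2 : ℕ) : ℝ) ≤ (F.L : ℝ) ^ (K - n) / 2 := by
    have := Nat.cast_div_le (m := F.L ^ (K - n)) (n := 2) (α := ℝ)
    push_cast at this ⊢
    exact this
  have hcast : (((F.P K).d * ((F.P K).L ^ (K - n) / 2) + (F.P K).L ^ (K - n) : ℕ) : ℝ) ≤ (5 / 2) * (F.L : ℝ) ^ (K - n) := by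
    rw [hd, hLF]; push_cast; nlinarith [hhalf]
  calc _ ≤ (5 / 2) * (F.L : ℝ) ^ (K - n) * (ε₀ * (((F.L : ℝ) ^ (K - n)) ^ 2)⁻¹) := mul_le_mul_of_nonneg_right hcast (by positivity)
    _ = (5 / 2) * ε₀ * ((F.L : ℝ) ^ (K - n))⁻¹ := by field_simp
    _ ≤ 3 * ε₀ * ((F.L : ℝ) ^ (K - n))⁻¹ := by
        have : 0 ≤ ε₀ * ((F.L : ℝ) ^ (K - n))⁻¹ := by positivity
        nlinarith

/-- The oscillation constant: `(η + η)·(3⌊L^k∕2⌋) ≤ 8ε₀` for `η ≤ (5∕2)ε₀L^{−k}`; stated from the raw `η`. [folklore] -/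
theorem omega_le {ε₀ : ℝ} (hε₀ : 0 ≤ ε₀) :
    ((((F.P K).d * ((F.P K).L ^ (K - n) / 2) + (F.P K).L ^ (K - n) : ℕ) : ℝ) * (ε₀ * (((F.L : ℝ) ^ (K - n)) ^ 2)⁻¹)
        + (((F.P K).d * ((F.P K).L ^ (K - n) / 2) + (F.P K).L ^ (K - n) : ℕ) : ℝ) * (ε₀ * (((F.L : ℝ) ^ (K - n)) ^ 2)⁻¹))
      * (((F.P K).d * ((F.P K).L ^ (K - n) / 2) : ℕ) : ℝ) ≤ 8 * ε₀ := by
  have hL : (0 : ℝ) < (F.L : ℝ) ^ (K - n) := by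
    have : (0 : ℝ) < F.L := by have := F.hL.2; exact_mod_cast (by omega : 0 < F.L)
    positivity
  have hd : ((F.P K).d : ℕ) = 3 := T3Family.P_d F K
  have hLF : ((F.P K).L : ℕ) = F.L := by norm_cast
  have hhalf : ((F.L ^ (K - n) / 2 : ℕ) : ℝ) ≤ (F.L : ℝ) ^ (K - n) / 2 := by
    have := Nat.cast_div_le (m := F.L ^ (K - n)) (n := 2) (α := ℝ)
    push_cast at this ⊢
    exact this
  have hcast : (((F.P K).d * ((F.P K).L ^ (K - n) / 2) + (F.P K).L ^ (K - n) : ℕ) : ℝ) ≤ (5 / 2) * (F.L : ℝ) ^ (K - n) := by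
    rw [hd, hLF]; push_cast; nlinarith [hhalf]
  have hcast2 : (((F.P K).d * ((F.P K).L ^ (K - n) / 2) : ℕ) : ℝ) ≤ (3 / 2) * (F.L : ℝ) ^ (K - n) := by
    rw [hd, hLF]; push_cast; nlinarith [hhalf]
  set w : ℝ := ε₀ * (((F.L : ℝ) ^ (K - n)) ^ 2)⁻¹ with hw
  have hw0 : 0 ≤ w := by positivity
  set A : ℝ := (((F.P K).d * ((F.P K).L ^ (K - n) / 2) + (F.P K).L ^ (K - n) : ℕ) : ℝ) with hA
  set B : ℝ := (((F.P K).d * ((F.P K).L ^ (K - n) / 2) : ℕ) : ℝ) with hB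
  have hA0 : 0 ≤ A := by positivity
  have hB0 : 0 ≤ B := by positivity
  have h1 : (A * w + A * w) * B ≤ ((5 / 2) * (F.L : ℝ) ^ (K - n) * w + (5 / 2) * (F.L : ℝ) ^ (K - n) * w) * ((3 / 2) * (F.L : ℝ) ^ (K - n)) :=
    mul_le_mul (by nlinarith [mul_le_mul_of_nonneg_right hcast hw0]) hcast2 hB0 (by positivity)
  have e : ((5 / 2) * (F.L : ℝ) ^ (K - n) * w + (5 / 2) * (F.L : ℝ) ^ (K - n) * w) * ((3 / 2) * (F.L : ℝ) ^ (K - n)) = (15 / 2) * ε₀ := by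
    rw [hw]; field_simp; ring
  rw [e] at h1
  linarith

variable {n K}

/-! ## §2 ★ (δ): the centre-anchored comb gauges are `3ε₀L^{−(K−n)}`-flat on the two blocks of their bond -/

/-- ★ **FLATNESS OF THE STENCIL GAUGES AT A `RegPr` BACKGROUND**: for `U₀ ∈ 𝔘_k(ε₀)` and every coarse bond `c` of the comparison level `K − n`, the comb gauge from the centre of
`c₋` makes `U₀` flat to `(3⌊L^k∕2⌋ + L^k)·ε₀L^{−2k} ≤ 3ε₀·L^{−(K−n)}` on every finest bond of the two blocks of `c` (the `η₀′`, `η′` of the certificate's (δ)).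
[cite: Balaban1985Averaging, (8) p.18, pp.24-25; Balaban1985Variational, (6) p.278] -/
theorem flat_centreAxial_of_regPr {ε₀ : ℝ} {U₀ : GaugeField (F.P K) 0 (Matrix.specialUnitaryGroup (Fin 2) ℂ)} (hreg : RegPr F n K ε₀ U₀)
    (hN4 : 4 * (F.P K).L ^ (K - n) ≤ (F.P K).sitesPerDir 0) (c : PBond (F.P K) (K - n)) (b : PBond (F.P K) 0)
    (hs : iterBlockOf (K - n) b.src = c.src ∨ iterBlockOf (K - n) b.src = c.tgt) (ht : iterBlockOf (K - n) b.tgt = c.src ∨ iterBlockOf (K - n) b.tgt = c.tgt) :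
    ‖((GaugeField.gaugeAct (axialT U₀ (toFine (K - n) c.src)) U₀ b : Matrix.specialUnitaryGroup (Fin 2) ℂ) : Matrix (Fin 2) (Fin 2) ℂ) - 1‖ ≤ 3 * ε₀ * ((F.L : ℝ) ^ (K - n))⁻¹ := by
  have hε₀ : 0 ≤ ε₀ := (pos_of_regPr F hreg).le
  have hδ : 0 ≤ ε₀ * (((F.L : ℝ) ^ (K - n)) ^ 2)⁻¹ := by
    have : (0 : ℝ) < F.L := by have := F.hL.2; exact_mod_cast (by omega : 0 < F.L)
    positivity
  have h := norm_gaugeAct_centreAxial_sub_one_le (le_standing (Nat.sub_le K n)) hN4 U₀ c hδ (fun q _ _ => plaq_le_of_regPr' F n K hreg q) b hs ht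
  exact h.trans (eta_le F n K hε₀)

/-! ## §3 ★★ (γ): the one-block oscillation of the relative stencil gauges is `≤ 8ε₀` -/

/-- ★★ **THE `hosc` BINDER OF `exists_obLift_gaugeKernel` AT A `RegPr` BACKGROUND, `ω := 8ε₀`**: for `U₀ ∈ 𝔘_k(ε₀)`, the centre-anchored comb gauges
`σ_c := axialT U₀ (toFine (K−n) c₋)`, every coarse bond `c`, every finest bond `b` of the two blocks of `c` and every `c′` with `c′₋ = coarsen (K−n) b₋`:
`‖σ_c(b₋)σ_{c′}(b₋)⁻¹ − σ_c^{(K−n)}(c′₋)σ_{c′}^{(K−n)}(c′₋)⁻¹‖ ≤ 8ε₀` — the transport inconsistency on the kernel support is the holonomy of fine loops inside ONE block,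
`≤ c·(L^{K−n})²·ε₀L^{−2(K−n)}`, k-UNIFORM. [cite: Balaban1985Averaging, (11)-(13) p.19, (19) p.21, pp.24-25; Balaban1985Variational, (6) p.278] -/
theorem osc_centreAxial_of_regPr {ε₀ : ℝ} {U₀ : GaugeField (F.P K) 0 (Matrix.specialUnitaryGroup (Fin 2) ℂ)} (hreg : RegPr F n K ε₀ U₀)
    (hN4 : 4 * (F.P K).L ^ (K - n) ≤ (F.P K).sitesPerDir 0) (c : PBond (F.P K) (K - n)) (b : PBond (F.P K) 0)
    (hs : iterBlockOf (K - n) b.src = c.src ∨ iterBlockOf (K - n) b.src = c.tgt) (_ht : iterBlockOf (K - n) b.tgt = c.src ∨ iterBlockOf (K - n) b.tgt = c.tgt)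
    (c' : PBond (F.P K) (K - n)) (hc' : c'.src = coarsen (K - n) b.src) :
    ‖(((axialT U₀ (toFine (K - n) c.src)) b.src * ((axialT U₀ (toFine (K - n) c'.src)) b.src)⁻¹ : Matrix.specialUnitaryGroup (Fin 2) ℂ) : Matrix (Fin 2) (Fin 2) ℂ) -
        ((transfUp (axialT U₀ (toFine (K - n) c.src)) (K - n) c'.src * (transfUp (axialT U₀ (toFine (K - n) c'.src)) (K - n) c'.src)⁻¹ :
          Matrix.specialUnitaryGroup (Fin 2) ℂ) : Matrix (Fin 2) (Fin 2) ℂ)‖ ≤ 8 * ε₀ := by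
  have hε₀ : 0 ≤ ε₀ := (pos_of_regPr F hreg).le
  have hL0 : (0 : ℝ) < F.L := by have := F.hL.2; exact_mod_cast (by omega : 0 < F.L)
  have hδ : 0 ≤ ε₀ * (((F.L : ℝ) ^ (K - n)) ^ 2)⁻¹ := by positivity
  have hk : K - n ≤ (F.P K).m + (F.P K).K := le_standing (Nat.sub_le K n)
  have hd : 2 ≤ (F.P K).d := by rw [T3Family.P_d]; norm_num
  -- the block of `b₋` is `c′₋`, one of the two blocks of `c`
  have hx : iterBlockOf (K - n) b.src = c'.src := by rw [hc', coarsen_eq_iterBlockOf]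
  have hc'mem : c'.src = c.src ∨ c'.src = c.tgt := by rw [← hx]; exact hs
  -- flatness of both gauged fields on the block of `c′₋`, with the raw `η`
  set η : ℝ := (((F.P K).d * ((F.P K).L ^ (K - n) / 2) + (F.P K).L ^ (K - n) : ℕ) : ℝ) * (ε₀ * (((F.L : ℝ) ^ (K - n)) ^ 2)⁻¹) with hη
  have hη0 : 0 ≤ η := by positivity
  have hflat : ∀ (c₀ : PBond (F.P K) (K - n)) (b₀ : PBond (F.P K) 0),
      (iterBlockOf (K - n) b₀.src = c₀.src ∨ iterBlockOf (K - n) b₀.src = c₀.tgt) → (iterBlockOf (K - n) b₀.tgt = c₀.src ∨ iterBlockOf (K - n) b₀.tgt = c₀.tgt) →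
      ‖((GaugeField.gaugeAct (axialT U₀ (toFine (K - n) c₀.src)) U₀ b₀ : Matrix.specialUnitaryGroup (Fin 2) ℂ) : Matrix (Fin 2) (Fin 2) ℂ) - 1‖ ≤ η :=
    fun c₀ b₀ hs₀ ht₀ => norm_gaugeAct_centreAxial_sub_one_le hk hN4 U₀ c₀ hδ (fun q _ _ => plaq_le_of_regPr' F n K hreg q) b₀ hs₀ ht₀
  have hg : ∀ b₀ : PBond (F.P K) 0, iterBlockOf (K - n) b₀.src = c'.src → iterBlockOf (K - n) b₀.tgt = c'.src →
      ‖((GaugeField.gaugeAct (axialT U₀ (toFine (K - n) c.src)) U₀ b₀ : Matrix.specialUnitaryGroup (Fin 2) ℂ) : Matrix (Fin 2) (Fin 2) ℂ) - 1‖ ≤ η := by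
    intro b₀ h1 h2
    rcases hc'mem with e | e
    · exact hflat c b₀ (Or.inl (h1.trans e)) (Or.inl (h2.trans e))
    · exact hflat c b₀ (Or.inr (h1.trans e)) (Or.inr (h2.trans e))
  have hg' : ∀ b₀ : PBond (F.P K) 0, iterBlockOf (K - n) b₀.src = c'.src → iterBlockOf (K - n) b₀.tgt = c'.src →
      ‖((GaugeField.gaugeAct (axialT U₀ (toFine (K - n) c'.src)) U₀ b₀ : Matrix.specialUnitaryGroup (Fin 2) ℂ) : Matrix (Fin 2) (Fin 2) ℂ) - 1‖ ≤ η :=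
    fun b₀ h1 h2 => hflat c' b₀ (Or.inl h1) (Or.inl h2)
  have h := norm_relGauge_centre_osc_le hd hk hN4 (axialT U₀ (toFine (K - n) c.src)) (axialT U₀ (toFine (K - n) c'.src)) U₀ c'.src hη0 hη0 hg hg' b.src hx
  exact h.trans (omega_le F n K hε₀)

/-! ## §4 Both rows packaged (the background enters the certificate only here) -/

/-- **THE STENCIL ROWS OF THE `obLift` CERTIFICATE AT A `RegPr` BACKGROUND**: flatness `3ε₀·L^{−(K−n)}` (for (δ)) and oscillation `8ε₀` (for (γ)), both k-uniform, for the gauges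
`fun c ↦ axialT U₀ (toFine (K − n) c.src)`. [cite: Balaban1985Averaging, (8) p.18, (11)-(13) p.19, pp.24-25; Balaban1985Variational, (6) p.278, (46) p.285] -/
theorem stencilRows_of_regPr {ε₀ : ℝ} {U₀ : GaugeField (F.P K) 0 (Matrix.specialUnitaryGroup (Fin 2) ℂ)} (hreg : RegPr F n K ε₀ U₀)
    (hN4 : 4 * (F.P K).L ^ (K - n) ≤ (F.P K).sitesPerDir 0) :
    (∀ (c : PBond (F.P K) (K - n)) (b : PBond (F.P K) 0),
        (iterBlockOf (K - n) b.src = c.src ∨ iterBlockOf (K - n) b.src = c.tgt) → (iterBlockOf (K - n) b.tgt = c.src ∨ iterBlockOf (K - n) b.tgt = c.tgt) →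
        ‖((GaugeField.gaugeAct (axialT U₀ (toFine (K - n) c.src)) U₀ b : Matrix.specialUnitaryGroup (Fin 2) ℂ) : Matrix (Fin 2) (Fin 2) ℂ) - 1‖ ≤ 3 * ε₀ * ((F.L : ℝ) ^ (K - n))⁻¹) ∧
    (∀ (c : PBond (F.P K) (K - n)) (b : PBond (F.P K) 0),
        (iterBlockOf (K - n) b.src = c.src ∨ iterBlockOf (K - n) b.src = c.tgt) → (iterBlockOf (K - n) b.tgt = c.src ∨ iterBlockOf (K - n) b.tgt = c.tgt) →
        ∀ c' : PBond (F.P K) (K - n), c'.src = coarsen (K - n) b.src →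
          ‖(((axialT U₀ (toFine (K - n) c.src)) b.src * ((axialT U₀ (toFine (K - n) c'.src)) b.src)⁻¹ : Matrix.specialUnitaryGroup (Fin 2) ℂ) : Matrix (Fin 2) (Fin 2) ℂ) -
              ((transfUp (axialT U₀ (toFine (K - n) c.src)) (K - n) c'.src * (transfUp (axialT U₀ (toFine (K - n) c'.src)) (K - n) c'.src)⁻¹ :
                Matrix.specialUnitaryGroup (Fin 2) ℂ) : Matrix (Fin 2) (Fin 2) ℂ)‖ ≤ 8 * ε₀) :=
  ⟨fun c b hs ht => flat_centreAxial_of_regPr F hreg hN4 c b hs ht, fun c b hs ht c' hc' => osc_centreAxial_of_regPr F hreg hN4 c b hs ht c' hc'⟩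

end Summit.QuantumFields.YangMills.Theorems.Prop7TwistDefectOfRegPr

end
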